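import Summits.CriticalPhenomena.PercolationContinuityZ3.Theorems.SahiAEBoxExtensionCoord

/-!
# Extension of bounded supermodular / two-sided-bounded MTP₂ functions from an open box to the whole space

Support file of the Sahi cell (`prim-sahi`, typer seat, generation 22; `--supports stmt-CriticalPhenomena-4575`).
Theorems only (no definitions, no named facts, no sorries).

Iterating the one-coordinate trace extension `exists_supermodular_extension_coord` of
`SahiAEBoxExtensionCoord.lean` over the coordinates (the coordinates already treated are free, the others still
constrained to the box):

* `exists_supermodular_extension_of_box` — a bounded measurable `ψ : ℝ^ι → ℝ` supermodular on every pair of points of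
  an open box `∏ᵢ (lᵢ, uᵢ)` agrees on the box with a bounded measurable function supermodular at EVERY pair of `ℝ^ι`;
* `exists_mtp2_extension_of_box` — the multiplicative form: a measurable `G : ℝ^ι → [c, M]` (`0 < c`, `M < ∞`) with
  `G(x) G(y) ≤ G(x ∧ y) G(x ∨ y)` for all `x, y` in the open box agrees on the box with a measurable `Ĝ`,
  `0 < c' ≤ Ĝ ≤ M' < ∞`, MTP₂ at every pair of `ℝ^ι`; `exists_mtp2_extension_of_openUnitCube` — the unit cube.

Used by `SahiAEBorelVersionPosPi.lean` (uniformly positive Borel everywhere-MTP₂ versions under every finite product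
of σ-finite measures on `ℝ`, atoms allowed).  No sorries, no new axioms.
-/

noncomputable section

namespace Summit.CriticalPhenomena.PercolationContinuityZ3.Theorems.SahiAEFourFunctions

open MeasureTheory Set Filter Topology Function
open scoped ENNReal NNReal

variable {ι : Type*}

/-! ### All coordinates: extension from an open box to `ℝ^ι` -/

section Box

variable [Fintype ι]

/-- **Extension from an open box.**  A bounded measurable `ψ : ℝ^ι → ℝ` which is supermodular on every pair of points
of the open box `∏ᵢ (lᵢ, uᵢ)` (`lᵢ < uᵢ`) agrees on the box with a bounded measurable function which is supermodular at
EVERY pair of points of `ℝ^ι` (one coordinate at a time, `exists_supermodular_extension_coord`). [this work] -/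
theorem exists_supermodular_extension_of_box (l u : ι → ℝ) (hlu : ∀ j, l j < u j) (ψ : (ι → ℝ) → ℝ)
    (hψ : Measurable ψ) {K : ℝ} (hK : ∀ x, |ψ x| ≤ K)
    (hsm : ∀ x ∈ Set.pi univ (fun j => Ioo (l j) (u j)), ∀ y ∈ Set.pi univ (fun j => Ioo (l j) (u j)),
      ψ x + ψ y ≤ ψ (x ⊓ y) + ψ (x ⊔ y)) :
    ∃ ψ' : (ι → ℝ) → ℝ, Measurable ψ' ∧ (∃ K' : ℝ, ∀ x, |ψ' x| ≤ K') ∧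
      (∀ x ∈ Set.pi univ (fun j => Ioo (l j) (u j)), ψ' x = ψ x) ∧ ∀ x y, ψ' x + ψ' y ≤ ψ' (x ⊓ y) + ψ' (x ⊔ y) := by
  classical
  set B : Set (ι → ℝ) := Set.pi univ (fun j => Ioo (l j) (u j)) with hB
  -- `W S`: the coordinates outside `S` are constrained to the box, those in `S` are free
  set W : Finset ι → Set (ι → ℝ) := fun S => {x | ∀ j, j ∉ S → l j < x j ∧ x j < u j} with hW
  set m : ι → ℝ := fun j => (l j + u j) / 2 with hm
  have hmW : ∀ S, m ∈ W S := fun S j _ => by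
    simp only [hm]; constructor <;> linarith [hlu j]
  have hWinf : ∀ S, ∀ x ∈ W S, ∀ y ∈ W S, x ⊓ y ∈ W S := fun S x hx y hy j hj =>
    ⟨lt_min (hx j hj).1 (hy j hj).1, (min_le_left _ _).trans_lt (hx j hj).2⟩
  have hWsup : ∀ S, ∀ x ∈ W S, ∀ y ∈ W S, x ⊔ y ∈ W S := fun S x hx y hy j hj =>
    ⟨(hx j hj).1.trans_le (le_max_left _ _), max_lt (hx j hj).2 (hy j hj).2⟩
  have hBW : ∀ S, ∀ x ∈ B, x ∈ W S := fun S x hx j _ => by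
    have := Set.mem_univ_pi.1 hx j; exact ⟨this.1, this.2⟩
  have key : ∀ S : Finset ι, ∃ ψ' : (ι → ℝ) → ℝ, Measurable ψ' ∧ (∃ K' : ℝ, ∀ x, |ψ' x| ≤ K') ∧
      (∀ x ∈ B, ψ' x = ψ x) ∧ ∀ x ∈ W S, ∀ y ∈ W S, ψ' x + ψ' y ≤ ψ' (x ⊓ y) + ψ' (x ⊔ y) := by
    intro S
    induction S using Finset.induction_on with
    | empty =>
        refine ⟨ψ, hψ, ⟨K, hK⟩, fun x _ => rfl, fun x hx y hy => hsm x ?_ y ?_⟩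
        · exact Set.mem_univ_pi.2 fun j => hx j (Finset.notMem_empty j)
        · exact Set.mem_univ_pi.2 fun j => hy j (Finset.notMem_empty j)
    | insert i S hiS ih =>
        obtain ⟨ψ₁, hψ₁m, ⟨K₁, hK₁⟩, hψ₁B, hψ₁sm⟩ := ih
        have hVi : ∀ x ∈ W (insert i S), ∀ s, update x i s ∈ W (insert i S) := by
          intro x hx s j hj
          have hji : j ≠ i := fun h => hj (h ▸ Finset.mem_insert_self i S)
          rw [update_of_ne hji]
          exact hx j hj
        have hsm₁ : ∀ x ∈ W (insert i S), ∀ y ∈ W (insert i S), l i < x i → x i < u i → l i < y i → y i < u i →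
            ψ₁ x + ψ₁ y ≤ ψ₁ (x ⊓ y) + ψ₁ (x ⊔ y) := by
          intro x hx y hy hx1 hx2 hy1 hy2
          refine hψ₁sm x (fun j hj => ?_) y (fun j hj => ?_)
          · by_cases hji : j = i
            · subst hji; exact ⟨hx1, hx2⟩
            · exact hx j (by simp [hji, hj])
          · by_cases hji : j = i
            · subst hji; exact ⟨hy1, hy2⟩
            · exact hy j (by simp [hji, hj])
        obtain ⟨ψ₂, hψ₂m, hψ₂K, hψ₂eq, hψ₂sm⟩ := exists_supermodular_extension_coord (W (insert i S)) i (hlu i)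
          hVi (hWinf _) (hWsup _) (hmW _) ψ₁ hψ₁m hK₁ hsm₁
        refine ⟨ψ₂, hψ₂m, ⟨4 * K₁, hψ₂K⟩, fun x hx => ?_, hψ₂sm⟩
        have := Set.mem_univ_pi.1 hx i
        rw [hψ₂eq x this.1 this.2, hψ₁B x hx]
  obtain ⟨ψ', h1, h2, h3, h4⟩ := key Finset.univ
  exact ⟨ψ', h1, h2, h3, fun x y => h4 x (fun j hj => (hj (Finset.mem_univ j)).elim) y
    (fun j hj => (hj (Finset.mem_univ j)).elim)⟩

/-- **Multiplicative form: extension of two-sided-bounded MTP₂ functions from an open box.**  A measurable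
`G : ℝ^ι → [c, M]` (`0 < c`, `M < ∞`) with `G(x) G(y) ≤ G(x ∧ y) G(x ∨ y)` for all `x, y` in the open box
`∏ᵢ (lᵢ, uᵢ)` agrees on the box with a measurable `Ĝ`, `0 < c' ≤ Ĝ ≤ M' < ∞`, which is MTP₂ at EVERY pair of points
of `ℝ^ι` (`log`/`exp` of `exists_supermodular_extension_of_box`). [this work] -/
theorem exists_mtp2_extension_of_box (l u : ι → ℝ) (hlu : ∀ j, l j < u j) (G : (ι → ℝ) → ℝ≥0∞)
    (hG : Measurable G) {c M : ℝ≥0∞} (hc : c ≠ 0) (hM : M ≠ ∞) (hcG : ∀ x, c ≤ G x) (hGM : ∀ x, G x ≤ M)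
    (hMTP : ∀ x ∈ Set.pi univ (fun j => Ioo (l j) (u j)), ∀ y ∈ Set.pi univ (fun j => Ioo (l j) (u j)),
      G x * G y ≤ G (x ⊓ y) * G (x ⊔ y)) :
    ∃ G' : (ι → ℝ) → ℝ≥0∞, Measurable G' ∧ (∃ c' M' : ℝ≥0∞, c' ≠ 0 ∧ M' ≠ ∞ ∧ ∀ x, c' ≤ G' x ∧ G' x ≤ M') ∧
      (∀ x ∈ Set.pi univ (fun j => Ioo (l j) (u j)), G' x = G x) ∧ ∀ x y, G' x * G' y ≤ G' (x ⊓ y) * G' (x ⊔ y) := by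
  have hcT : c ≠ ∞ := ne_top_of_le_ne_top hM ((hcG l).trans (hGM l))
  have hGT : ∀ x, G x ≠ ∞ := fun x => ne_top_of_le_ne_top hM (hGM x)
  have hG0 : ∀ x, G x ≠ 0 := fun x => (lt_of_lt_of_le (pos_iff_ne_zero.2 hc) (hcG x)).ne'
  have hGpos : ∀ x, 0 < (G x).toReal := fun x => ENNReal.toReal_pos (hG0 x) (hGT x)
  -- the additive function `ψ = log G`
  set ψ : (ι → ℝ) → ℝ := fun x => Real.log (G x).toReal with hψdef
  have hψm : Measurable ψ := Real.measurable_log.comp (ENNReal.measurable_toReal.comp hG)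
  set K : ℝ := max |Real.log c.toReal| |Real.log M.toReal| with hKdef
  have hK : ∀ x, |ψ x| ≤ K := fun x => by
    have h1 : Real.log c.toReal ≤ Real.log (G x).toReal :=
      Real.log_le_log (ENNReal.toReal_pos hc hcT) (ENNReal.toReal_mono (hGT x) (hcG x))
    have h2 : Real.log (G x).toReal ≤ Real.log M.toReal :=
      Real.log_le_log (hGpos x) (ENNReal.toReal_mono hM (hGM x))
    have h3 : -K ≤ Real.log c.toReal := by
      have ha := neg_abs_le (Real.log c.toReal)
      have hb := le_max_left |Real.log c.toReal| |Real.log M.toReal|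
      simp only [hKdef]; linarith
    exact abs_le.2 ⟨h3.trans h1, h2.trans (le_max_of_le_right (le_abs_self _))⟩
  have hsm : ∀ x ∈ Set.pi univ (fun j => Ioo (l j) (u j)), ∀ y ∈ Set.pi univ (fun j => Ioo (l j) (u j)),
      ψ x + ψ y ≤ ψ (x ⊓ y) + ψ (x ⊔ y) := by
    intro x hx y hy
    have h := hMTP x hx y hy
    have hL : (G x * G y).toReal ≤ (G (x ⊓ y) * G (x ⊔ y)).toReal :=
      ENNReal.toReal_mono (ENNReal.mul_ne_top (hGT _) (hGT _)) h
    rw [ENNReal.toReal_mul, ENNReal.toReal_mul] at hL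
    simp only [hψdef]
    rw [← Real.log_mul (hGpos x).ne' (hGpos y).ne', ← Real.log_mul (hGpos _).ne' (hGpos _).ne']
    exact Real.log_le_log (mul_pos (hGpos x) (hGpos y)) hL
  obtain ⟨ψ', hψ'm, ⟨K', hK'⟩, hψ'eq, hψ'sm⟩ := exists_supermodular_extension_of_box l u hlu ψ hψm hK hsm
  refine ⟨fun x => ENNReal.ofReal (Real.exp (ψ' x)), ENNReal.measurable_ofReal.comp (Real.measurable_exp.comp hψ'm),
    ⟨ENNReal.ofReal (Real.exp (-K')), ENNReal.ofReal (Real.exp K'), (ENNReal.ofReal_pos.2 (Real.exp_pos _)).ne',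
      ENNReal.ofReal_ne_top, fun x => ⟨?_, ?_⟩⟩, fun x hx => ?_, fun x y => ?_⟩
  · exact ENNReal.ofReal_le_ofReal (Real.exp_le_exp.2 (abs_le.1 (hK' x)).1)
  · exact ENNReal.ofReal_le_ofReal (Real.exp_le_exp.2 (abs_le.1 (hK' x)).2)
  · show ENNReal.ofReal (Real.exp (ψ' x)) = G x
    rw [hψ'eq x hx, hψdef, Real.exp_log (hGpos x), ENNReal.ofReal_toReal (hGT x)]
  · show ENNReal.ofReal (Real.exp (ψ' x)) * ENNReal.ofReal (Real.exp (ψ' y)) ≤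
      ENNReal.ofReal (Real.exp (ψ' (x ⊓ y))) * ENNReal.ofReal (Real.exp (ψ' (x ⊔ y)))
    rw [← ENNReal.ofReal_mul (Real.exp_pos _).le, ← ENNReal.ofReal_mul (Real.exp_pos _).le, ← Real.exp_add,
      ← Real.exp_add]
    exact ENNReal.ofReal_le_ofReal (Real.exp_le_exp.2 (hψ'sm x y))

/-- The unit-cube special case used by the transport chain: extension from the open unit cube `(0,1)^ι`.
[this work] -/
theorem exists_mtp2_extension_of_openUnitCube (G : (ι → ℝ) → ℝ≥0∞) (hG : Measurable G) {c M : ℝ≥0∞}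
    (hc : c ≠ 0) (hM : M ≠ ∞) (hcG : ∀ x, c ≤ G x) (hGM : ∀ x, G x ≤ M)
    (hMTP : ∀ x ∈ Set.pi univ (fun _ : ι => Ioo (0 : ℝ) 1), ∀ y ∈ Set.pi univ (fun _ : ι => Ioo (0 : ℝ) 1),
      G x * G y ≤ G (x ⊓ y) * G (x ⊔ y)) :
    ∃ G' : (ι → ℝ) → ℝ≥0∞, Measurable G' ∧ (∃ c' M' : ℝ≥0∞, c' ≠ 0 ∧ M' ≠ ∞ ∧ ∀ x, c' ≤ G' x ∧ G' x ≤ M') ∧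
      (∀ x ∈ Set.pi univ (fun _ : ι => Ioo (0 : ℝ) 1), G' x = G x) ∧
      ∀ x y, G' x * G' y ≤ G' (x ⊓ y) * G' (x ⊔ y) :=
  exists_mtp2_extension_of_box (fun _ => 0) (fun _ => 1) (fun _ => zero_lt_one) G hG hc hM hcG hGM hMTP

end Box

end Summit.CriticalPhenomena.PercolationContinuityZ3.Theorems.SahiAEFourFunctions
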